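import Summits.QuantumAdvantage.QuantumAdvantage.Theses.MeasureZeroOne
import Literature.Computability.Complexity.ResourceBoundedMeasure
import Literature.Computability.Complexity.TimeBounds

/-!
# Birth skeleton (BC3) — crux `BQPneEXP` of route `MeasureZeroOne` (stmt-QuantumAdvantage-1354)

The crux is the route's second load-bearing hypothesis, `BQPneEXP := BQP ≠ EXP`
(`Summits/QuantumAdvantage/QuantumAdvantage/Theses/MeasureZeroOne.lean`, rank 5; hypothesis-type,
non-relativizing: Heller 1986 gives an oracle with `BPP = EXP`).  The tree PROVES `BQP ⊆ EXP`
(`BQP_subset_PSPACE_holds`, `PSPACE_subset_EXP_holds`), and also `BQP ⊆ PP`, `PP ⊆ PSPACE`, so every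
cut of the shape "`X ≠ EXP` for a proved `X ⊇ BQP`" is a ONE-piece strengthening (the containment
half is already a tree theorem) and is not filed.

THE LINE (route-native: resource-bounded measure one level up — van Melkebeek's EXP-measure =
Lutz's `p₂`-measure, martingales computable in time `2^{n^{O(1)}} = 2^{(log N)^{O(1)}}` in the
length `N` of the prefix bet on, VanMelkebeek2000 §2.5.2 p. 47–48): **`BQP ≠ EXP` because `BQP` is
NEGLIGIBLE IN `EXP` while `EXP` is not** — the Lutz-school form of a separation from `EXP`
("`μ(X | EXP) = 0 ⟹ X ≠ EXP`", measure conservation).  Two named stubs, both stated over tree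
declarations only (`IsMartingale`, `successSet` of `ResourceBoundedMeasure.lean`; `TimeComputable`
of `TimeBounds.lean` with the explicit quasi-polynomial clock `N ↦ 2^{(⌊log₂ N⌋ + 2)^k}`; the exact
`(num, den)` value code of `IsPComputable`):

* `stub_bqpEXPMeasureZero` (OPEN, hypothesis-type, the bet): `μ_EXP(BQP) = 0` — ONE exactly-computed
  rational martingale running in time `2^{(log₂ N + 2)^k}` for some `k` succeeds on every `BQP`
  language.  Sufficient known condition: `BQP ⊆ DTIME[2^{n^c}]` for ONE fixed `c` ("DTIME[2^{n^c}]
  has EXP-measure zero", vM §2.5.3 p. 48) — a fixed-level dequantization nobody expects to prove; the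
  honest obstruction to the direct attack (EXP-uniform union lemma over exact `2^{O(n^c)}`-time
  simulators of the `c`-th `BQTIME(n^c)` machine) is that the family is not EXP-uniform in `c` — the
  same reason `EXP` itself is not EXP-null.  Consistent with the route's QMH (`BQPNotSmall`,
  `μ_p(BQP) ≠ 0`): `E` is exactly such a class (`μ_p(E) ≠ 0`, `μ_EXP(E) = 0`), so the pair says
  "`BQP` sits in `EXP` measure-wise like `E`".  Not summit-strength: it holds if `BQP = P`
  (`μ_EXP(P) = 0`), where the summit fails.  Irrefutable by current technique (its negation is a
  super-fixed-exponential deterministic lower bound for `BQP`).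
  Sources: VanMelkebeek2000 §2.5.2–2.5.3 (EXP-measure; `DTIME[2^{n^c}]` EXP-null), Ch. 7 Cor. 7.2.1
  (EXP-measure of degrees in EXP); Lutz1992 (`p₂ = ` time `2^{(log n)^{O(1)}}`, `μ(· | E₂)`);
  HitchcockSekoniShafei2025 = arXiv:2508.07619 §4.4 (only COUNTING martingales are known to cover
  `BQP`; de-counting them costs `2^{O(n^c)}` per machine — the uniformity wall again).
* `stub_expMeasureConservation` (THEOREM IN PRINT, provable now; size M–L in the tree's TM2 model):
  measure conservation at the EXP level, `μ_EXP(EXP) ≠ 0` (vM §2.5.3 p. 48 verbatim: "In particular,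
  `μ_E(E) ≠ 0` and `μ_EXP(EXP) ≠ 0`"; Lutz1992 Measure Conservation).  Plan: the tree's combinatorial
  core is level-free — `IsMartingale.not_succeedsOn_diagLanguage` (no martingale succeeds on its own
  greedy diagonal language) — so it suffices that `diagLanguage d ∈ EXP` for a martingale computable
  in time `2^{(log₂ N + 2)^k}`: deciding `s_N` takes `N + 1 ≤ 2^{n+1}` evaluations of `d` on prefixes
  of length `≤ N + 1`, i.e. time `2^{n+1} · 2^{(n+3)^k} ≤ 2^{n^{k+1}}` eventually — a clocked TM2 loop,
  the `p`-level twin of which is the tree's discharged fact `not_pMeasureZero_E_holds`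
  (`ResourceBoundedMeasureFactsProofs.lean`; template to copy).  Why it might fail AS TYPED: only via
  the clock convention (`2^{(⌊log₂ N⌋+2)^k}` vs `2^{(log N)^{O(1)}}` — equivalent up to the choice of
  `k`, base `≥ 2` so constants are absorbed) or the halting rule of `TimeComputable` (whole input
  popped: the clock is `≥ N + 2` for `k ≥ 1`).

Composition `BQPneEXP_of (h₁ : Registered.stub_bqpEXPMeasureZero) (h₂ : Registered.stub_expMeasureConservation) : BQPneEXP`
(sorry-free, two lines; the `Registered.stub_*` abbrevs are the stub statements verbatim, keyed by
stub name for the A12 skeleton audit): if `BQP = EXP`, the covering martingale of stub 1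
covers `EXP`, contradicting stub 2.  The seam is deliberately trivial (BC: "the triviality of the
join is irrelevant"); the content is the CUT — an open smallness hypothesis strictly between
"`BQP` in a fixed level of `EXP`" and the crux, plus a theorem in print — and neither piece gives the
crux or the summit on its own (BC3 probes, folder `bc/`: `stubᵢ → BQPneEXP` and
`stubᵢ → QuantumAdvantage` by `first | exact? | simpa | aesop` (and the extended BC2 combinator) FAIL
for both stubs; so do `example : stubᵢ := by exact?`).

Disproof used: none exists (`ledger crux ls stmt-QuantumAdvantage-1354`: no workfiles, no
`Disproof.lean`, no `Theorems/BQPneEXP/Negative/*`).  Negatives index (`ledger negatives --problem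
QuantumAdvantage`, 2026-08-17: 6 refuted statements — RegulatorThird, ShorLocallyDark, CubicStability,
SpinorFlattening, KummerSector, SeparableFrames): none concerns `EXP`, time classes or measure, so
neither stub restates a refuted statement.

`sorry` occurs ONLY in the two `stub_*` theorems.
-/

-- `Summit.<Summit>.<Problem>`: the duplicate `QuantumAdvantage.QuantumAdvantage` is mandated.
set_option linter.dupNamespace false

namespace Summit.QuantumAdvantage.QuantumAdvantage.Cruxes.BQPneEXP.Birth

open Literature.Computability.Complexity

/-! ## The two registered stubs (signatures inlined over tree declarations; the ONLY sorries) -/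

/-- **Stub 1 — `BQP` has EXP-measure zero** (`μ_EXP(BQP) = 0`; OPEN, hypothesis-type, the bet of the
line).  One martingale computable in time `2^{(log₂ N + 2)^k}` out-guesses every polynomial-time
quantum language with unbounded gain.  Implied by `BQP ⊆ DTIME[2^{n^c}]` for a fixed `c`
(vM §2.5.3); consistent with QMH (`E` is `p`-non-null and EXP-null); false only if `BQP` escapes every
fixed level of `EXP` in the strong measure sense.  INLINED notion (no Literature name yet for
EXP-measure; cf. the design note "NOT here: `p₂`/EXP-measure versions" of
`ResourceBoundedMeasureFacts.lean`): `∃ d, IsMartingale d ∧ (∃ k, TimeComputable id ⟨num,den⟩-code d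
(N ↦ 2^{(⌊log₂ N⌋+2)^k})) ∧ BQP ⊆ successSet d` — the tree's `pMeasureZero_iff` shape with the
polynomial clock of `IsPComputable` replaced by van Melkebeek's EXP-measure clock
`2^{(log N)^{O(1)}}` (= Lutz's `p₂`).  [cite: VanMelkebeek2000, §2.5.2–2.5.3, Cor. 7.2.1]
[cite: Lutz1992, §3–4] [cite: HitchcockSekoniShafei2025, §4.4] -/
theorem stub_bqpEXPMeasureZero :
    ∃ d : List Bool → ℚ, Literature.Computability.Complexity.IsMartingale d ∧
      (∃ k : ℕ, Literature.Computability.Complexity.TimeComputable (fun w : List Bool => w)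
        (fun q : ℚ => (Literature.Computability.Complexity.encodingIntBool.pairBool
          Computability.encodingNatBool).encode (q.num, q.den))
        d (fun N => 2 ^ ((Nat.log 2 N + 2) ^ k))) ∧
      Literature.Computability.Cryptography.BQP ⊆ Literature.Computability.Complexity.successSet d := by
  sorry

/-- **Stub 2 — measure conservation at the EXP level** (`μ_EXP(EXP) ≠ 0`; THEOREM IN PRINT,
provable now): no EXP-computable exact rational martingale succeeds on all of
`EXP = ⋃ₖ DTIME[2^{n^k}]` — its greedy diagonal language (`diagLanguage d`, on which `d` never
succeeds: `IsMartingale.not_succeedsOn_diagLanguage`) is decidable in time `2^{n+1} · 2^{(n+3)^k}`,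
inside `EXP`.  [cite: VanMelkebeek2000, §2.5.3 p. 48 ("μ_EXP(EXP) ≠ 0")] [cite: Lutz1992, §4
(Measure Conservation Theorem)] -/
theorem stub_expMeasureConservation :
    ¬ ∃ d : List Bool → ℚ, Literature.Computability.Complexity.IsMartingale d ∧
      (∃ k : ℕ, Literature.Computability.Complexity.TimeComputable (fun w : List Bool => w)
        (fun q : ℚ => (Literature.Computability.Complexity.encodingIntBool.pairBool
          Computability.encodingNatBool).encode (q.num, q.den))
        d (fun N => 2 ^ ((Nat.log 2 N + 2) ^ k))) ∧
      Literature.Computability.Complexity.EXP ⊆ Literature.Computability.Complexity.successSet d := by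
  sorry

/-! ## Name-keyed aliases of the stub statements (hypotheses of the composition, A12 skeleton audit:
the composition's hypotheses must be registered obligations or declared stubs BY NAME) -/

namespace Registered

/-- Alias of stub 1's statement (`μ_EXP(BQP) = 0`), keyed by the registered stub name. -/
abbrev stub_bqpEXPMeasureZero : Prop :=
  ∃ d : List Bool → ℚ, Literature.Computability.Complexity.IsMartingale d ∧
      (∃ k : ℕ, Literature.Computability.Complexity.TimeComputable (fun w : List Bool => w)
        (fun q : ℚ => (Literature.Computability.Complexity.encodingIntBool.pairBool
          Computability.encodingNatBool).encode (q.num, q.den))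
        d (fun N => 2 ^ ((Nat.log 2 N + 2) ^ k))) ∧
      Literature.Computability.Cryptography.BQP ⊆ Literature.Computability.Complexity.successSet d

/-- Alias of stub 2's statement (`μ_EXP(EXP) ≠ 0`), keyed by the registered stub name. -/
abbrev stub_expMeasureConservation : Prop :=
  ¬ ∃ d : List Bool → ℚ, Literature.Computability.Complexity.IsMartingale d ∧
      (∃ k : ℕ, Literature.Computability.Complexity.TimeComputable (fun w : List Bool => w)
        (fun q : ℚ => (Literature.Computability.Complexity.encodingIntBool.pairBool
          Computability.encodingNatBool).encode (q.num, q.den))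
        d (fun N => 2 ^ ((Nat.log 2 N + 2) ^ k))) ∧
      Literature.Computability.Complexity.EXP ⊆ Literature.Computability.Complexity.successSet d

end Registered

/-! ## Kernel-checked composition (no sorry) -/

/-- COMPOSITION (real proof): the two stubs give the crux `BQPneEXP` BY NAME.  If `BQP = EXP`, the
EXP-computable martingale covering `BQP` (stub 1) covers `EXP`, contradicting measure conservation
(stub 2). [cite: VanMelkebeek2000, §2.5.3 (measure conservation as a separation principle)] -/
theorem BQPneEXP_of (h₁ : Registered.stub_bqpEXPMeasureZero)
    (h₂ : Registered.stub_expMeasureConservation) :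
    Summit.QuantumAdvantage.QuantumAdvantage.Theses.MeasureZeroOne.BQPneEXP := by
  unfold Summit.QuantumAdvantage.QuantumAdvantage.Theses.MeasureZeroOne.BQPneEXP
  intro heq
  obtain ⟨d, hd, hc, hs⟩ := id (α := Registered.stub_bqpEXPMeasureZero) h₁
  exact h₂ ⟨d, hd, hc, fun L hL => hs (heq ▸ hL)⟩

/-- Consistency check only (an `example`, so nothing sorry-tainted concluding the crux enters the
environment — a later `exact?` probe importing this file cannot pick up a fake proof of `BQPneEXP`):
the composition typechecks against the stubs exactly as stated. -/
example : Summit.QuantumAdvantage.QuantumAdvantage.Theses.MeasureZeroOne.BQPneEXP :=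
  BQPneEXP_of stub_bqpEXPMeasureZero stub_expMeasureConservation

end Summit.QuantumAdvantage.QuantumAdvantage.Cruxes.BQPneEXP.Birth
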